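import Summits.AnomalousDissipation.AnomalousDissipation.Theorems.SawtoothPulseCascadeApproxForcedProfile
import Summits.AnomalousDissipation.AnomalousDissipation.Theorems.SawtoothPulseCascadeK2ParallelForced

/-!
# Backward heat realignment of the heat-lag injection via the sharper profile
(route `AnomalousDissipation/SawtoothPulseCascade`; helper for the crux ApproxSol58 =
stmt-AnomalousDissipation-19688, registered stub `stub_responseL2` / S1 `stub_responseL2Envelope`:
the realignment pipeline, slot level)

K2″ (`K2PhaseGrowthClassical`) bounds responses to comb data injected at the START `a` of a half-slot,
while the heat-lag source `ν rate(t) U''` acts throughout the slot `[a, a + τ]`.  The forced parallel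
profile `F` it creates (from zero) is realigned to the slot start: there is a smooth `1`-periodic comb
profile `g` (Fourier support on the odd multiples of `N`) whose HOMOGENEOUS heat flow over the slot ends
exactly at `F(a + τ)`.  Construction (all heat flows forward): `g := F̃(a + τ)` where `F̃` is the forced
profile with the SHARPER source profile `u_{δ'}`, `δ'² = δ² − 8π²νN²τ > 0` (the budget), using the Gaussian
factor `𝓕(u_δ)(m) = e^{−δ²m²/(2N²)}·(…)` of `…ApproxProfileGaussian`:
`𝓕(ν u_δ'')(m) = e^{−4π²νm²τ} 𝓕(ν u_{δ'}'')(m)`, so coefficient by coefficient the heat multiplier over the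
slot turns `F̃(a+τ)` into `F(a+τ)` (`…ApproxHeatCoefficients`), and smooth periodic profiles are determined
by their coefficients.  Size: `|g(y)| ≤ 6√(2π) ν N (∫|rate|)/δ'` (`…ApproxForcedProfile`).

* §1 the sharper profile and the coefficient relation; §2 the realignment identity;
* §3 the packaged existence statement for a slot `[a, a + τ]` with a smooth rate `r`.
-/

set_option linter.dupNamespace false

noncomputable section

namespace Summit.AnomalousDissipation.AnomalousDissipation.Theorems.SawtoothPulseCascade.ApproxResponse

open Set MeasureTheory Complex
open scoped ContDiff
open Literature.Analysis Literature.Analysis.FunctionSpaces Literature.Analysis.FluidPDE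
open Literature.Analysis.FluidPDE.SawtoothCascade
open Summit.AnomalousDissipation.AnomalousDissipation.Theorems.SawtoothPulseCascade.K2Classical

/-! ## §1 The sharper profile -/

/-- Under the budget `8π²νN²τ < δ²` the sharper width `δ' = √(δ² − 8π²νN²τ)` is positive. -/
theorem sharpWidth_pos {δ ν τ : ℝ} {N : ℕ} (hbud : 8 * Real.pi ^ 2 * ν * (N : ℝ) ^ 2 * τ < δ ^ 2) :
    0 < Real.sqrt (δ ^ 2 - 8 * Real.pi ^ 2 * ν * (N : ℝ) ^ 2 * τ) :=
  Real.sqrt_pos.2 (by linarith)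

/-- `δ'² + 8π²νN²τ = δ²`. -/
theorem sharpWidth_sq {δ ν τ : ℝ} {N : ℕ} (hbud : 8 * Real.pi ^ 2 * ν * (N : ℝ) ^ 2 * τ < δ ^ 2) :
    Real.sqrt (δ ^ 2 - 8 * Real.pi ^ 2 * ν * (N : ℝ) ^ 2 * τ) ^ 2 = δ ^ 2 - 8 * Real.pi ^ 2 * ν * (N : ℝ) ^ 2 * τ :=
  Real.sq_sqrt (by linarith)

/-- `δ' ≤ δ` (for `δ > 0`, `ν, τ ≥ 0`). -/
theorem sharpWidth_le {δ ν τ : ℝ} {N : ℕ} (hδ : 0 < δ) (hν : 0 ≤ ν) (hτ : 0 ≤ τ) :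
    Real.sqrt (δ ^ 2 - 8 * Real.pi ^ 2 * ν * (N : ℝ) ^ 2 * τ) ≤ δ := by
  rw [Real.sqrt_le_left hδ.le]
  have h1 : 0 ≤ 8 * Real.pi ^ 2 * ν * (N : ℝ) ^ 2 * τ := by positivity
  linarith

/-- **The Gaussian factor across the slot**: the source coefficients of the true profile `u_δ` are those
of the sharper profile `u_{δ'}` times the heat multiplier `e^{−4π²νm²τ}` over the slot. -/
theorem fourierCoeff_source_realign {δ : ℝ} (hδ : 0 < δ) {N : ℕ} (hN : N ≠ 0) {ν τ : ℝ}
    (hbud : 8 * Real.pi ^ 2 * ν * (N : ℝ) ^ 2 * τ < δ ^ 2) (κ : ℝ) (m : ℤ) :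
    fourierCoeff (AddCircle.liftIco 1 0 fun y => ((κ * deriv (deriv
        (fun y : ℝ => roundedSaw δ (2 * Real.pi * N * y) / (2 * Real.pi * N))) y : ℝ) : ℂ)) m =
      ((Real.exp (-(4 * Real.pi ^ 2 * ν * (m : ℝ) ^ 2) * τ) : ℝ) : ℂ) *
        fourierCoeff (AddCircle.liftIco 1 0 fun y => ((κ * deriv (deriv
          (fun y : ℝ => roundedSaw (Real.sqrt (δ ^ 2 - 8 * Real.pi ^ 2 * ν * (N : ℝ) ^ 2 * τ))
            (2 * Real.pi * N * y) / (2 * Real.pi * N))) y : ℝ) : ℂ)) m := by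
  have hδ' := sharpWidth_pos hbud
  have hN' : (N : ℝ) ≠ 0 := Nat.cast_ne_zero.2 hN
  rw [fourierCoeff_source hδ N κ m, fourierCoeff_source hδ' N κ m, fourierCoeff_profile hδ hN m,
    fourierCoeff_profile hδ' hN m, sharpWidth_sq hbud]
  have hexp : Real.exp (-(δ ^ 2 * (m : ℝ) ^ 2 / (2 * (N : ℝ) ^ 2))) =
      Real.exp (-(4 * Real.pi ^ 2 * ν * (m : ℝ) ^ 2) * τ) *
        Real.exp (-((δ ^ 2 - 8 * Real.pi ^ 2 * ν * (N : ℝ) ^ 2 * τ) * (m : ℝ) ^ 2 / (2 * (N : ℝ) ^ 2))) := by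
    rw [← Real.exp_add]
    congr 1
    field_simp
    ring
  rw [hexp]
  push_cast
  ring

/-! ## §2 The realignment identity -/

section Realign

variable {δ : ℝ} {N : ℕ} {ν a τ : ℝ} {r : ℝ → ℝ} {c F Fs : ℝ → ℝ → ℝ}

/-- **Realignment identity.** On the slot `[a, a + τ]` (`τ > 0`, `ν ≥ 0`, budget `8π²νN²τ < δ²`, rate `r`
smooth) let `F` be the forced profile from zero with the true source `r(t) · κ u_δ''`, `Fs` the forced
profile from zero with the sharper source `r(t) · κ u_{δ'}''`, and `c` the homogeneous heat profile on the
slot with `c(a) = Fs(a + τ)`.  Then `c(a + τ) = F(a + τ)`. -/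
theorem realign_eq (hδ : 0 < δ) (hN : N ≠ 0) (hτ : 0 < τ)
    (hbud : 8 * Real.pi ^ 2 * ν * (N : ℝ) ^ 2 * τ < δ ^ 2) (hr : ContDiff ℝ ∞ r) (κ : ℝ)
    (hF : ContDiffOn ℝ ∞ (Function.uncurry F) (Icc a (a + τ) ×ˢ univ))
    (hFper : ∀ t ∈ Icc a (a + τ), Function.Periodic (F t) 1) (hF0 : F a = fun _ => 0)
    (heatF : ∀ t ∈ Icc a (a + τ), ∀ y, derivWithin (fun s => F s y) (Icc a (a + τ)) t =
      ν * deriv (deriv (F t)) y + r t * (κ * deriv (deriv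
        (fun y : ℝ => roundedSaw δ (2 * Real.pi * N * y) / (2 * Real.pi * N))) y))
    (hFs : ContDiffOn ℝ ∞ (Function.uncurry Fs) (Icc a (a + τ) ×ˢ univ))
    (hFsper : ∀ t ∈ Icc a (a + τ), Function.Periodic (Fs t) 1) (hFs0 : Fs a = fun _ => 0)
    (heatFs : ∀ t ∈ Icc a (a + τ), ∀ y, derivWithin (fun s => Fs s y) (Icc a (a + τ)) t =
      ν * deriv (deriv (Fs t)) y + r t * (κ * deriv (deriv
        (fun y : ℝ => roundedSaw (Real.sqrt (δ ^ 2 - 8 * Real.pi ^ 2 * ν * (N : ℝ) ^ 2 * τ))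
          (2 * Real.pi * N * y) / (2 * Real.pi * N))) y))
    (hc : ContDiffOn ℝ ∞ (Function.uncurry c) (Icc a (a + τ) ×ˢ univ))
    (hcper : ∀ t ∈ Icc a (a + τ), Function.Periodic (c t) 1)
    (heatc : ∀ t ∈ Icc a (a + τ), ∀ y, derivWithin (fun s => c s y) (Icc a (a + τ)) t =
      ν * deriv (deriv (c t)) y)
    (hca : c a = Fs (a + τ)) :
    c (a + τ) = F (a + τ) := by
  have hab : a < a + τ := by linarith
  have hδ' := sharpWidth_pos hbud
  have hb : a + τ ∈ Icc a (a + τ) := right_mem_Icc.2 hab.le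
  -- smoothness / periodicity of the two profiles to compare
  have hcb : ContDiff ℝ ∞ (c (a + τ)) := contDiff_slice_of_contDiffOn_uncurry hc hb
  have hFb : ContDiff ℝ ∞ (F (a + τ)) := contDiff_slice_of_contDiffOn_uncurry hF hb
  refine profile_eq_of_fourierCoeff_eq hcb (hcper _ hb) hFb (hFper _ hb) fun m => ?_
  -- the separated-source data
  have hV : ∀ {δ₁ : ℝ}, 0 < δ₁ → ContDiff ℝ ∞ (fun y : ℝ => κ * deriv (deriv
      (fun y : ℝ => roundedSaw δ₁ (2 * Real.pi * N * y) / (2 * Real.pi * N))) y) := by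
    intro δ₁ hδ₁
    have := (contDiff_profile hδ₁ N).iterate_deriv 2
    simpa using contDiff_const.mul this
  have hVper : ∀ δ₁ : ℝ, Function.Periodic (fun y : ℝ => κ * deriv (deriv
      (fun y : ℝ => roundedSaw δ₁ (2 * Real.pi * N * y) / (2 * Real.pi * N))) y) 1 := fun δ₁ y => by
    simp only [(ShearCascade.periodic_deriv (ShearCascade.periodic_deriv (periodic_profile δ₁ N))) y]
  -- the three coefficient identities
  have Hc := fourierCoeff_heatProfile_eq_exp_mul hab hc hcper heatc m hb
  have HF := fourierCoeff_heatProfile_forced hab hF hFper hr (hV hδ) (hVper δ) heatF m hb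
  have HFs := fourierCoeff_heatProfile_forced hab hFs hFsper hr (hV hδ') (hVper _) heatFs m hb
  rw [hF0, fourierCoeff_liftIco_zero, sub_zero, fourierCoeff_source_realign hδ hN hbud κ m] at HF
  rw [hFs0, fourierCoeff_liftIco_zero, sub_zero] at HFs
  rw [add_sub_cancel_left] at Hc HF HFs
  rw [Hc, hca]
  -- algebra: `E·X = I·(e·Ṽ)`, `E·X̃ = I·Ṽ`, `e = E⁻¹` ⟹ `X = e·X̃`
  set E : ℂ := ((Real.exp ((4 * Real.pi ^ 2 * ν * (m : ℝ) ^ 2) * τ) : ℝ) : ℂ) with hE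
  set e : ℂ := ((Real.exp (-(4 * Real.pi ^ 2 * ν * (m : ℝ) ^ 2) * τ) : ℝ) : ℂ) with he
  have hEe : e * E = 1 := by
    rw [hE, he, ← Complex.ofReal_mul, ← Real.exp_add]
    simp
  have hE0 : E ≠ 0 := by rw [hE]; exact_mod_cast (Real.exp_pos _).ne'
  set X := fourierCoeff (AddCircle.liftIco 1 0 fun y => (F (a + τ) y : ℂ)) m
  set Xs := fourierCoeff (AddCircle.liftIco 1 0 fun y => (Fs (a + τ) y : ℂ)) m
  -- from HF : E * X = I * (e * Vs),  HFs : E * Xs = I * Vs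
  have h1 : E * X = e * (E * Xs) := by rw [HF, HFs]; ring
  have h2 : X = e * Xs := by
    calc X = (e * E) * X := by rw [hEe, one_mul]
      _ = e * (E * X) := by ring
      _ = e * (e * (E * Xs)) := by rw [h1]
      _ = e * Xs * (e * E) := by ring
      _ = e * Xs := by rw [hEe, mul_one]
  exact h2.symm

end Realign


/-! ## §3 The realigned comb profile of a slot -/

/-- **The realigned comb profile.** For a slot `[a, a + τ]` (`τ > 0`, `ν > 0`) with smooth rate `r`,
profile width `δ > 0`, frequency `N ≠ 0` and budget `8π²νN²τ < δ²` there is a smooth `1`-periodic `g`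
with: (i) Fourier support on the odd multiples of `N` (a residual comb); (ii)
`|g(y)| ≤ 6√(2π) ν N (∫ₐ^{a+τ}|r|) / δ'`, `δ' = √(δ² − 8π²νN²τ)`; (iii) REALIGNMENT: the homogeneous heat
profile over the slot started from `g` ends at `F(a + τ)` for every forced profile `F` from zero with the
heat-lag source `r(t) · ν u_δ''(y)`, `u_δ(y) = roundedSaw δ (2πNy)/(2πN)`. -/
theorem exists_realigned {δ : ℝ} (hδ : 0 < δ) {N : ℕ} (hN : N ≠ 0) {ν a τ : ℝ} (hν : 0 < ν) (hτ : 0 < τ)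
    (hbud : 8 * Real.pi ^ 2 * ν * (N : ℝ) ^ 2 * τ < δ ^ 2) {r : ℝ → ℝ} (hr : ContDiff ℝ ∞ r) :
    ∃ g : ℝ → ℝ, ContDiff ℝ ∞ g ∧ Function.Periodic g 1 ∧
      (∀ m : ℤ, (¬ ∃ n : ℤ, m = (2 * n + 1) * (N : ℤ)) →
        fourierCoeff (AddCircle.liftIco 1 0 fun y => (g y : ℂ)) m = 0) ∧
      (∀ y, |g y| ≤ 6 * Real.sqrt (2 * Real.pi) * ν * N * (∫ s in a..(a + τ), |r s|) /
        Real.sqrt (δ ^ 2 - 8 * Real.pi ^ 2 * ν * (N : ℝ) ^ 2 * τ)) ∧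
      (∀ c F : ℝ → ℝ → ℝ,
        ContDiffOn ℝ ∞ (Function.uncurry c) (Icc a (a + τ) ×ˢ univ) →
        (∀ t ∈ Icc a (a + τ), Function.Periodic (c t) 1) →
        (∀ t ∈ Icc a (a + τ), ∀ y, derivWithin (fun s => c s y) (Icc a (a + τ)) t =
          ν * deriv (deriv (c t)) y) →
        c a = g →
        ContDiffOn ℝ ∞ (Function.uncurry F) (Icc a (a + τ) ×ˢ univ) →
        (∀ t ∈ Icc a (a + τ), Function.Periodic (F t) 1) → F a = (fun _ => 0) →
        (∀ t ∈ Icc a (a + τ), ∀ y, derivWithin (fun s => F s y) (Icc a (a + τ)) t =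
          ν * deriv (deriv (F t)) y + r t * (ν * deriv (deriv
            (fun y : ℝ => roundedSaw δ (2 * Real.pi * N * y) / (2 * Real.pi * N))) y)) →
        c (a + τ) = F (a + τ)) := by
  have hab : a < a + τ := by linarith
  have hδ' := sharpWidth_pos hbud
  have hb : a + τ ∈ Icc a (a + τ) := right_mem_Icc.2 hab.le
  -- the sharper source and its forced profile from zero
  set us : ℝ → ℝ := fun y => roundedSaw (Real.sqrt (δ ^ 2 - 8 * Real.pi ^ 2 * ν * (N : ℝ) ^ 2 * τ))
    (2 * Real.pi * N * y) / (2 * Real.pi * N) with hus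
  have hVs : ContDiff ℝ ∞ (fun y : ℝ => ν * deriv (deriv us) y) := by
    have := (contDiff_profile hδ' N).iterate_deriv 2
    simpa [hus] using contDiff_const.mul this
  have hVsper : Function.Periodic (fun y : ℝ => ν * deriv (deriv us) y) 1 := fun y => by
    simp only [hus, (ShearCascade.periodic_deriv (ShearCascade.periodic_deriv
      (periodic_profile (Real.sqrt (δ ^ 2 - 8 * Real.pi ^ 2 * ν * (N : ℝ) ^ 2 * τ)) N))) y]
  obtain ⟨Fs, hFs, hFsper, heatFs, hFs0⟩ := exists_heatProfile_forced hab hν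
    (g := fun _ : ℝ => (0 : ℝ)) contDiff_const (fun _ => rfl) (σ := fun t y => r t * (ν * deriv (deriv us) y))
    (contDiffOn_uncurry_mul_sep hr hVs _) (fun t _ y => by simp only [hVsper y])
  refine ⟨Fs (a + τ), contDiff_slice_of_contDiffOn_uncurry hFs hb, hFsper _ hb, fun m hm => ?_, fun y => ?_,
    fun c F hc hcper heatc hca hF hFper hF0 heatF => ?_⟩
  · exact fourierCoeff_forcedProfile_eq_zero hδ' hN hab hFs hFsper hFs0 hr heatFs hm hb
  · have h := abs_forcedProfile_le hδ' hN hab hν.le hFs hFsper hFs0 hr heatFs hb y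
    rwa [abs_of_pos hν] at h
  · exact realign_eq hδ hN hτ hbud hr ν hF hFper hF0 heatF hFs hFsper hFs0 heatFs hc hcper heatc hca


/-! ## §4 The cascade's half-slots -/

open Literature.Analysis.FluidPDE.SawtoothCascade.CascadeParams

/-- The cascade profile in the normal form of this file. -/
theorem cascade_U_eq (P : CascadeParams) (j : ℕ) :
    P.U j = fun y => roundedSaw (P.δ j) (2 * Real.pi * (P.N j : ℕ) * y) / (2 * Real.pi * (P.N j : ℕ)) := rfl

/-- `∫ |rateH_j| = γ` over the H half-slot (`γ ≥ 0`). -/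
theorem integral_abs_rateH (P : CascadeParams) (hγ : 0 ≤ P.γ) (j : ℕ) :
    ∫ s in tStart j..(tStart j + tHalf j), |P.rateH j s| = P.γ := by
  rw [← P.integral_rateH j]
  exact intervalIntegral.integral_congr fun s _ => abs_of_nonneg (P.rateH_nonneg hγ j s)

/-- `∫ |rateV_j| = γ` over the V half-slot (`γ ≥ 0`). -/
theorem integral_abs_rateV (P : CascadeParams) (hγ : 0 ≤ P.γ) (j : ℕ) :
    ∫ s in (tStart j + tHalf j)..(tStart j + tHalf j + tHalf j), |P.rateV j s| = P.γ := by
  rw [show tStart j + tHalf j + tHalf j = tStart (j + 1) by rw [tStart_succ]; ring, ← P.integral_rateV j]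
  exact intervalIntegral.integral_congr fun s _ => abs_of_nonneg (P.rateV_nonneg hγ j s)

/-- **Realigned comb profile of the H half-slot of phase `j`.**  For `δ₀ > 0`, `d > 0`, `N_j ≠ 0`,
`γ ≥ 0`, `ν > 0` and the budget `8π²νN_j² tHalf_j < δ_j²`: a smooth `1`-periodic `g` with Fourier support
on the odd multiples of `N_j`, `|g| ≤ 6√(2π) ν N_j γ / δ'_j`, whose homogeneous heat flow over the slot
ends at `F(tStart j + tHalf j)` for every forced parallel profile `F` from zero driven by the heat lag
`ν rateH_j U_j''`. -/
theorem exists_realigned_H (P : CascadeParams) (hδ₀ : 0 < P.δ₀) (hd : 0 < P.d) (hγ : 0 ≤ P.γ) {j : ℕ}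
    (hN : P.N j ≠ 0) {ν : ℝ} (hν : 0 < ν)
    (hbud : 8 * Real.pi ^ 2 * ν * (P.N j : ℝ) ^ 2 * tHalf j < P.δ j ^ 2) :
    ∃ g : ℝ → ℝ, ContDiff ℝ ∞ g ∧ Function.Periodic g 1 ∧
      (∀ m : ℤ, (¬ ∃ n : ℤ, m = (2 * n + 1) * (P.N j : ℤ)) →
        fourierCoeff (AddCircle.liftIco 1 0 fun y => (g y : ℂ)) m = 0) ∧
      (∀ y, |g y| ≤ 6 * Real.sqrt (2 * Real.pi) * ν * (P.N j) * P.γ /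
        Real.sqrt (P.δ j ^ 2 - 8 * Real.pi ^ 2 * ν * (P.N j : ℝ) ^ 2 * tHalf j)) ∧
      (∀ c F : ℝ → ℝ → ℝ,
        ContDiffOn ℝ ∞ (Function.uncurry c) (Icc (tStart j) (tStart j + tHalf j) ×ˢ univ) →
        (∀ t ∈ Icc (tStart j) (tStart j + tHalf j), Function.Periodic (c t) 1) →
        (∀ t ∈ Icc (tStart j) (tStart j + tHalf j), ∀ y,
          derivWithin (fun s => c s y) (Icc (tStart j) (tStart j + tHalf j)) t = ν * deriv (deriv (c t)) y) →
        c (tStart j) = g →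
        ContDiffOn ℝ ∞ (Function.uncurry F) (Icc (tStart j) (tStart j + tHalf j) ×ˢ univ) →
        (∀ t ∈ Icc (tStart j) (tStart j + tHalf j), Function.Periodic (F t) 1) → F (tStart j) = (fun _ => 0) →
        (∀ t ∈ Icc (tStart j) (tStart j + tHalf j), ∀ y,
          derivWithin (fun s => F s y) (Icc (tStart j) (tStart j + tHalf j)) t =
            ν * deriv (deriv (F t)) y + ν * (P.rateH j t * deriv (deriv (P.U j)) y)) →
        c (tStart j + tHalf j) = F (tStart j + tHalf j)) := by
  have hδ := P.δ_pos hδ₀ hd j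
  obtain ⟨g, hg, hgper, hcomb, hbound, hreal⟩ :=
    exists_realigned hδ hN hν (tHalf_pos j) hbud (P.contDiff_rateH j) (a := tStart j)
  refine ⟨g, hg, hgper, hcomb, fun y => ?_, fun c F hc hcper heatc hca hF hFper hF0 heatF => ?_⟩
  · have h := hbound y
    rwa [integral_abs_rateH P hγ j] at h
  · refine hreal c F hc hcper heatc hca hF hFper hF0 fun t ht y => ?_
    rw [heatF t ht y, cascade_U_eq]
    ring

/-- **Realigned comb profile of the V half-slot of phase `j`** (as `exists_realigned_H`, on
`[tStart j + tHalf j, tStart (j+1)]` with the rate `rateV_j`). -/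
theorem exists_realigned_V (P : CascadeParams) (hδ₀ : 0 < P.δ₀) (hd : 0 < P.d) (hγ : 0 ≤ P.γ) {j : ℕ}
    (hN : P.N j ≠ 0) {ν : ℝ} (hν : 0 < ν)
    (hbud : 8 * Real.pi ^ 2 * ν * (P.N j : ℝ) ^ 2 * tHalf j < P.δ j ^ 2) :
    ∃ g : ℝ → ℝ, ContDiff ℝ ∞ g ∧ Function.Periodic g 1 ∧
      (∀ m : ℤ, (¬ ∃ n : ℤ, m = (2 * n + 1) * (P.N j : ℤ)) →
        fourierCoeff (AddCircle.liftIco 1 0 fun y => (g y : ℂ)) m = 0) ∧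
      (∀ y, |g y| ≤ 6 * Real.sqrt (2 * Real.pi) * ν * (P.N j) * P.γ /
        Real.sqrt (P.δ j ^ 2 - 8 * Real.pi ^ 2 * ν * (P.N j : ℝ) ^ 2 * tHalf j)) ∧
      (∀ c F : ℝ → ℝ → ℝ,
        ContDiffOn ℝ ∞ (Function.uncurry c) (Icc (tStart j + tHalf j) (tStart (j + 1)) ×ˢ univ) →
        (∀ t ∈ Icc (tStart j + tHalf j) (tStart (j + 1)), Function.Periodic (c t) 1) →
        (∀ t ∈ Icc (tStart j + tHalf j) (tStart (j + 1)), ∀ y,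
          derivWithin (fun s => c s y) (Icc (tStart j + tHalf j) (tStart (j + 1))) t = ν * deriv (deriv (c t)) y) →
        c (tStart j + tHalf j) = g →
        ContDiffOn ℝ ∞ (Function.uncurry F) (Icc (tStart j + tHalf j) (tStart (j + 1)) ×ˢ univ) →
        (∀ t ∈ Icc (tStart j + tHalf j) (tStart (j + 1)), Function.Periodic (F t) 1) →
        F (tStart j + tHalf j) = (fun _ => 0) →
        (∀ t ∈ Icc (tStart j + tHalf j) (tStart (j + 1)), ∀ y,
          derivWithin (fun s => F s y) (Icc (tStart j + tHalf j) (tStart (j + 1))) t =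
            ν * deriv (deriv (F t)) y + ν * (P.rateV j t * deriv (deriv (P.U j)) y)) →
        c (tStart (j + 1)) = F (tStart (j + 1))) := by
  have hδ := P.δ_pos hδ₀ hd j
  have hend : tStart j + tHalf j + tHalf j = tStart (j + 1) := by rw [tStart_succ]; ring
  obtain ⟨g, hg, hgper, hcomb, hbound, hreal⟩ :=
    exists_realigned hδ hN hν (tHalf_pos j) hbud (P.contDiff_rateV j) (a := tStart j + tHalf j)
  rw [hend] at hbound hreal
  refine ⟨g, hg, hgper, hcomb, fun y => ?_, fun c F hc hcper heatc hca hF hFper hF0 heatF => ?_⟩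
  · have h := hbound y
    rwa [← hend, integral_abs_rateV P hγ j] at h
  · refine hreal c F hc hcper heatc hca hF hFper hF0 fun t ht y => ?_
    rw [heatF t ht y, cascade_U_eq]
    ring

end Summit.AnomalousDissipation.AnomalousDissipation.Theorems.SawtoothPulseCascade.ApproxResponse

end
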